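import Literature.NumberTheory.GaloisRepresentations.QuadraticIdeleNormResidueExact
import Literature.NumberTheory.QuadraticForms.HilbertSymbolNormCompatArchimedean
import Literature.NumberTheory.AdelicBaseChange.AdeleNormLocal
import Literature.NumberTheory.AdelicBaseChange.AdeleNormArchimedean
import HarnessLib

/-!
# Norm functoriality of the quadratic norm group along an extension of degree `≤ 3`:
# `X ∈ Lˣ · N(𝕀_{L(√d)}) ⟺ N_{L/K} X ∈ Kˣ · N(𝕀_{K(√d)})` for `[L : K] ≤ 3`, `d ∈ Kˣ`

Topic `NumberTheory/GaloisRepresentations` (global class field theory, quadratic case); namespace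
`Literature.NumberTheory.GaloisRepresentations`.  THEOREMS ONLY (no definition, no named fact, no instance, no `sorry`); net debt 0.

THE PRINT.  The norm-compatibility of the Artin map (Neukirch, *Algebraic Number Theory*, IV (6.4) locally, VI (5.2) globally): for
`K ⊆ L` and the abelian extension `K(√d)/K`, the Artin symbol of `L(√d)/L` at an idele `X` of `L` is the Artin symbol of `K(√d)/K` at
`N_{L/K} X`.  Read through the index-`2` norm groups (Cassels–Fröhlich VII §5.1 (B), §6; O'Meara 65:21 ∕ 71:19, the tree's ★
`mem_principalIdeles_sup_normIdeles_iff_prod_hilbertSymbol_eq_one`) this is the statement of the title.  It is proved HERE, elementarily,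
for `[L : K] ≤ 3` (the local degrees are then `1`, `2` or `3` at every place): both memberships are «total Hilbert symbol `= 1`»
(★ R4), the places `w` of `L` regroup over the places `v` of `K`, and in each fibre `∏_{w∣v} (X_w, d)_{L_w} = ((N X)_v, d)_{K_v}` by the
low-degree projection formula (★ `prod_hilbertSymbol_adicCompletion_eq_hilbertSymbol_prod_norm` at the finite places, ★
`prod_hilbertSymbol_completion_eq_hilbertSymbol_prod_norm` at the infinite ones) and the component formula `(N X)_v = ∏_{w∣v} N_{L_w/K_v} X_w`
of the idelic norm (FLT packet ★ `adeleRelNorm_snd∕fst_apply_eq_prod`, Cassels–Fröhlich II (19.19)).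

* `algebraMap_adicCompletion_extension_apply` — the square `K → K_v → L_w = K → L → L_w` at a finite place (Cassels–Fröhlich II (19.14)).
* **`mem_principalIdeles_sup_normIdeles_iff_ideleRelNorm_mem`** — THE HEAD.

USE (cell hodgecm-mathlib, G6 R6c∕R6d): with `L = K₀,j` a field factor of the Cartan algebra of a regular `γ₀ ∈ U(3)` (`[K₀,j : F] ≤ 3`) and
`d = θ`, this is the identity «`indicator_j (X_j) = indicator_F (N X_j)`» that, summed over `j` with `∏_j N X_j = N_{L/F}(det g)`, puts the
obstruction `cartanObs` in the sum-zero hyperplane [Rogawski1990, Prop. 3.5.2 (c)].  HC_CM is proved only modulo the printed citations until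
rung 0 closes; this file is quadratic idelic number theory and asserts nothing about unitary groups.

## References
* [NeukirchANT1999] J. Neukirch, *Algebraic Number Theory* (1999), Ch. IV (6.4), Ch. VI (5.2) (norm functoriality of the Artin map).
* [CasselsFrohlichANT1967] Cassels–Fröhlich (eds.), *Algebraic Number Theory* (1967), Ch. II §19 (19.14), (19.19); Ch. VII §5.1 (B), §6.
* [Omeara1963] O. T. O'Meara, *Introduction to Quadratic Forms* (1963), §65D Prop. 65:21, §71 Thms. 71:18, 71:19.
* [Rogawski1990] J. D. Rogawski, *Automorphic Representations of Unitary Groups in Three Variables* (1990), §3.5 Prop. 3.5.2 (c).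
-/

set_option autoImplicit false

noncomputable section

open NumberField IsDedekindDomain IsDedekindDomain.HeightOneSpectrum
open scoped Classical TensorProduct NumberField.LiesOver
open Literature.NumberTheory.QuadraticForms Literature.NumberTheory.AdelicBaseChange

namespace Literature.NumberTheory.GaloisRepresentations

variable (K L : Type) [Field K] [NumberField K] [Field L] [NumberField L] [Algebra K L]

/-- `K → K_v → L_w` agrees with `K → L → L_w` at a finite place `w ∣ v` (the square of the local base change `K_v ⊗_K L ≅ ∏_{w∣v} L_w`).
[cite: CasselsFrohlichANT1967, Ch. II §19 (19.14)] -/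
theorem algebraMap_adicCompletion_extension_apply (v : HeightOneSpectrum (𝓞 K)) (w : v.Extension (𝓞 L)) (d : K) :
    algebraMap (v.adicCompletion K) (w.1.adicCompletion L) (algebraMap K (v.adicCompletion K) d) =
      algebraMap L (w.1.adicCompletion L) (algebraMap K L d) := by
  have h1 := adicCompletionTensorAlgEquiv_tmul K L v (algebraMap K (v.adicCompletion K) d) 1 w
  rw [map_one, one_mul] at h1
  have h2 := adicCompletionTensorAlgEquiv_one_tmul K L v (algebraMap K L d) w
  rw [← h1, ← h2, Algebra.algebraMap_eq_smul_one, Algebra.algebraMap_eq_smul_one, ← TensorProduct.smul_tmul]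

/-- **NORM FUNCTORIALITY of the quadratic norm group in degree `≤ 3`.**  `K ⊆ L` number fields, `[L : K] ≤ 3`, `d ∈ Kˣ`, `X` an idele of
`L`: `X ∈ Lˣ · N(𝕀_{L(√d)})` (★ `principalIdeles L ⊔ normIdeles L d`) iff `N_{L/K} X ∈ Kˣ · N(𝕀_{K(√d)})`, `N_{L/K}` the idelic norm
(FLT packet ★ `ideleRelNorm`).  Equivalently: the quadratic Artin symbols of `L(√d)/L` at `X` and of `K(√d)/K` at `N_{L/K} X` agree.
[cite: NeukirchANT1999, Ch. VI (5.2)] [cite: CasselsFrohlichANT1967, Ch. VII §5.1 (B), §6] [cite: Omeara1963, §71 Thm. 71:19] -/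
theorem mem_principalIdeles_sup_normIdeles_iff_ideleRelNorm_mem (hKL : Module.finrank K L ≤ 3) {d : K} (hd0 : d ≠ 0) (X : ideleGroup L) :
    X ∈ principalIdeles L ⊔ normIdeles L (algebraMap K L d) ↔ ideleRelNorm K L X ∈ principalIdeles K ⊔ normIdeles K d := by
  have hd0' : algebraMap K L d ≠ 0 := (map_ne_zero _).2 hd0
  by_cases hsqK : IsSquare d
  · rw [normIdeles_eq_top_of_isSquare L (hsqK.map (algebraMap K L)) hd0', normIdeles_eq_top_of_isSquare K hsqK hd0]
    simp
  letI : ∀ v : HeightOneSpectrum (𝓞 K), Fintype (v.Extension (𝓞 L)) := fun v => Extension.fintype (𝓞 K) K L (𝓞 L) v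
  -- the bad finite places on both sides, and a finite set `SK` of places of `K` below all of them
  have hTKf : {v : HeightOneSpectrum (𝓞 K) | ideleFiniteComponent K v (ideleRelNorm K L X) ∉
      quadraticNormSubgroup (v.adicCompletion K) (algebraMap K (v.adicCompletion K) d)}.Finite :=
    finite_setOf_ideleFiniteComponent_not_mem_quadraticNormSubgroup hd0 _
  have hTLf : {w : HeightOneSpectrum (𝓞 L) | ideleFiniteComponent L w X ∉
      quadraticNormSubgroup (w.adicCompletion L) (algebraMap L (w.adicCompletion L) (algebraMap K L d))}.Finite :=
    finite_setOf_ideleFiniteComponent_not_mem_quadraticNormSubgroup hd0' _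
  set SK : Finset (HeightOneSpectrum (𝓞 K)) := hTKf.toFinset ∪ (hTLf.image fun w => w.under (𝓞 K)).toFinset with hSK_def
  set SL : Finset (HeightOneSpectrum (𝓞 L)) := (SK.sigma fun v => (Finset.univ : Finset (v.Extension (𝓞 L)))).image
      fun p => p.2.1 with hSL_def
  have hSK : ∀ v ∉ SK, ideleFiniteComponent K v (ideleRelNorm K L X) ∈
      quadraticNormSubgroup (v.adicCompletion K) (algebraMap K (v.adicCompletion K) d) := by
    intro v hv
    by_contra h
    exact hv (Finset.mem_union_left _ (hTKf.mem_toFinset.2 h))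
  have hSL : ∀ w ∉ SL, ideleFiniteComponent L w X ∈
      quadraticNormSubgroup (w.adicCompletion L) (algebraMap L (w.adicCompletion L) (algebraMap K L d)) := by
    intro w hw
    by_contra h
    apply hw
    rw [hSL_def, Finset.mem_image]
    refine ⟨⟨w.under (𝓞 K), ⟨w, rfl⟩⟩, ?_, rfl⟩
    rw [Finset.mem_sigma]
    exact ⟨Finset.mem_union_right _ ((hTLf.image _).mem_toFinset.2 ⟨w, h, rfl⟩), Finset.mem_univ _⟩
  -- the finite-part fibre identity, place by place
  have hfin : ∀ v : HeightOneSpectrum (𝓞 K),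
      ∏ w : v.Extension (𝓞 L), hilbertSymbol (w.1.adicCompletion L) (ideleFiniteComponent L w.1 X : w.1.adicCompletion L)
          (algebraMap L (w.1.adicCompletion L) (algebraMap K L d)) =
        hilbertSymbol (v.adicCompletion K) (ideleFiniteComponent K v (ideleRelNorm K L X) : v.adicCompletion K)
          (algebraMap K (v.adicCompletion K) d) := by
    intro v
    have hθ : algebraMap K (v.adicCompletion K) d ≠ 0 := (map_ne_zero _).2 hd0
    have key := prod_hilbertSymbol_adicCompletion_eq_hilbertSymbol_prod_norm K L v hKL hθ
      (fun w => (ideleFiniteComponent L w.1 X : w.1.adicCompletion L)) (fun w => Units.ne_zero _)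
    have step : ∏ w : v.Extension (𝓞 L), hilbertSymbol (w.1.adicCompletion L) (ideleFiniteComponent L w.1 X : w.1.adicCompletion L)
          (algebraMap L (w.1.adicCompletion L) (algebraMap K L d)) =
        ∏ w : v.Extension (𝓞 L), hilbertSymbol (w.1.adicCompletion L)
          (algebraMap (v.adicCompletion K) (w.1.adicCompletion L) (algebraMap K (v.adicCompletion K) d))
          (ideleFiniteComponent L w.1 X : w.1.adicCompletion L) :=
      Finset.prod_congr rfl fun w _ => by rw [hilbertSymbol_comm, algebraMap_adicCompletion_extension_apply]
    rw [step, hilbertSymbol_comm (ideleFiniteComponent K v (ideleRelNorm K L X) : v.adicCompletion K), val_ideleFiniteComponent,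
      show ((ideleRelNorm K L X : ideleGroup K) : AdeleRing (𝓞 K) K).2 v = (adeleRelNorm K L X).2 v from rfl,
      adeleRelNorm_snd_apply_eq_prod K L v]
    simp only [val_ideleFiniteComponent] at key
    convert key using 2; rfl
  -- the infinite-part fibre identity, place by place
  have hinf : ∀ v : InfinitePlace K,
      ∏ w : v.Extension L, hilbertSymbol w.1.Completion (ideleInfiniteComponent L w.1 X : w.1.Completion)
          (algebraMap L w.1.Completion (algebraMap K L d)) =
        hilbertSymbol v.Completion (ideleInfiniteComponent K v (ideleRelNorm K L X) : v.Completion)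
          (algebraMap K v.Completion d) := by
    intro v
    have hθ : algebraMap K v.Completion d ≠ 0 := (map_ne_zero _).2 hd0
    have key := prod_hilbertSymbol_completion_eq_hilbertSymbol_prod_norm K L v hKL hθ
      (fun w => (ideleInfiniteComponent L w.1 X : w.1.Completion)) (fun w => Units.ne_zero _)
    have step : ∏ w : v.Extension L, hilbertSymbol w.1.Completion (ideleInfiniteComponent L w.1 X : w.1.Completion)
          (algebraMap L w.1.Completion (algebraMap K L d)) =
        ∏ w : v.Extension L, hilbertSymbol w.1.Completion (algebraMap v.Completion w.1.Completion (algebraMap K v.Completion d))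
          (ideleInfiniteComponent L w.1 X : w.1.Completion) :=
      Finset.prod_congr rfl fun w _ => by
        rw [hilbertSymbol_comm, ← IsScalarTower.algebraMap_apply K v.Completion w.1.Completion d]; rfl
    rw [step, hilbertSymbol_comm (ideleInfiniteComponent K v (ideleRelNorm K L X) : v.Completion), val_ideleInfiniteComponent,
      show ((ideleRelNorm K L X : ideleGroup K) : AdeleRing (𝓞 K) K).1 v = (adeleRelNorm K L X).1 v from rfl,
      adeleRelNorm_fst_apply_eq_prod K L v]
    simp only [val_ideleInfiniteComponent] at key
    convert key using 2; rfl
  -- regroup the `L`-products over the places of `K`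
  have hPfin : ∏ w ∈ SL, hilbertSymbol (w.adicCompletion L) (ideleFiniteComponent L w X : w.adicCompletion L)
        (algebraMap L (w.adicCompletion L) (algebraMap K L d)) =
      ∏ v ∈ SK, hilbertSymbol (v.adicCompletion K) (ideleFiniteComponent K v (ideleRelNorm K L X) : v.adicCompletion K)
        (algebraMap K (v.adicCompletion K) d) := by
    rw [hSL_def, Finset.prod_image, Finset.prod_sigma]
    · exact Finset.prod_congr rfl fun v _ => hfin v
    · rintro ⟨v, w⟩ - ⟨v', w'⟩ - h
      change w.1 = w'.1 at h
      have hv : v = v' := by rw [← w.2, ← w'.2, h]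
      subst hv
      rw [Subtype.ext h]
  have hPinf : ∏ w : InfinitePlace L, hilbertSymbol w.Completion (ideleInfiniteComponent L w X : w.Completion)
        (algebraMap L w.Completion (algebraMap K L d)) =
      ∏ v : InfinitePlace K, hilbertSymbol v.Completion (ideleInfiniteComponent K v (ideleRelNorm K L X) : v.Completion)
        (algebraMap K v.Completion d) := by
    rw [← Fintype.prod_fiberwise (fun w : InfinitePlace L => w.comap (algebraMap K L))
      (fun w : InfinitePlace L => hilbertSymbol w.Completion (ideleInfiniteComponent L w X : w.Completion)
        (algebraMap L w.Completion (algebraMap K L d)))]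
    exact Fintype.prod_congr _ _ fun v => by convert hinf v using 1
  -- the two total symbols agree
  have hPK := mem_principalIdeles_sup_normIdeles_iff_prod_hilbertSymbol_eq_one hsqK (ideleRelNorm K L X) SK hSK
  rw [← hPfin, ← hPinf] at hPK
  by_cases hsqL : IsSquare (algebraMap K L d)
  · -- every `L`-symbol is `1`, so both sides hold
    have h1 : ∀ (F' : Type) [Field F'] [Algebra L F'] (x : F'), hilbertSymbol F' x (algebraMap L F' (algebraMap K L d)) = 1 := by
      intro F' _ _ x
      rw [hilbertSymbol_comm]
      exact hilbertSymbol_eq_one_of_isSquare (hsqL.map _) ((map_ne_zero _).2 hd0') x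
    rw [normIdeles_eq_top_of_isSquare L hsqL hd0', hPK]
    simp only [h1, Finset.prod_const_one, mul_one, sup_top_eq, Subgroup.mem_top]
  · rw [mem_principalIdeles_sup_normIdeles_iff_prod_hilbertSymbol_eq_one hsqL X SL hSL, hPK]

end Literature.NumberTheory.GaloisRepresentations

end
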